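import Mathlib
import HarnessLib

/-!
# Route `UnitScaleTilt`, crux K1 child «MinimiserStabilityRegPr» (stmt-QuantumFields-19200) — DOOR-VACUITY CERTIFICATE, FILE B-II: **THE PROFILE — A NON-CONSTANT FUNCTION ON
# THE CYCLE `ℤ∕N` WHOSE SECOND DIFFERENCE OF THE SECOND DIFFERENCE IS BLOCK-CONSTANT** (blocks of length `L`, `N = L·M`), and its `ℤ`-periodic lift

Cell `ym3-torus`, width seat `ym3-torus-px4` (gen 6).  THEOREMS ONLY (0 `def`, 0 `sorry`); Mathlib only.  ★★OWNER ym3-torus-plan g29 RULING №16 (5), ★ ym-ust-19200-p1 g17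
WORD 21 (b) GO; LOCATE `ym3-torus-px4/g6/LOCATE-VACUITY-CERT-px4g6.md` §1 (`ψ₀ := Δ₁⁻¹Δ₁⁻¹g`).  YM₃ on T³ is a ladder rung (R3), not d = 4, not Clay; nothing of
`hcoW`∕`hcoS`∕E′∕EX∕the crux is claimed; `--supports stmt-QuantumFields-19200`, count-neutral.

WHY.  The Landau clause (1.38) of the door's binder, in the tree's multiplier form at one averaging level (FILE B-I ✓`Prop7LineFieldZdLetters.isLandau138_one_lineField`), holds
for the longitudinal pure-gauge profile `a(m) = t·(ψ(m) − ψ(m+1))·σ₃` exactly when the third difference of `a` — i.e. `−t·(Δ₁²ψ)(m)·σ₃` — is constant on the blocks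
`{m : m ∕ L = q}`.  This file produces such a `ψ`, periodic (so that it comes from the torus) and NOT of constant increment (so that `a ≢ 0`), by linear algebra on the cycle.

WHAT IS PROVED (ns `…Theorems.Prop7VacuityBlockProfile`; `Δ₁ψ(τ) := ψ(τ+1) − 2ψ(τ) + ψ(τ−1)` written out, no `def`).
* §1 ★ `sum_mul_lap_eq_neg_sum_sq` — summation by parts on `ZMod N`: `Σ_τ ψ(τ)·Δ₁ψ(τ) = −Σ_τ (ψ(τ+1) − ψ(τ))²`; `eq_const_of_lap_eq_zero` — `Δ₁ψ = 0 ⇒ ψ = ψ(0)`;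
  ★★ `exists_lap_eq_of_sum_eq_zero` — for every `h` with `Σ h = 0` there is `φ` with `Δ₁φ = h` and `Σ φ = 0` (the restriction of `Δ₁` to the mean-zero hyperplane is an
  injective endomorphism of a finite-dimensional space, hence onto: Mathlib `LinearMap.injective_iff_surjective`).
* §2 ★★ `exists_blockProfile` — for `N = L·M`, `0 < L`, `L < N`: there are `θ φ g : ZMod N → ℝ` and a constant `C` with `Δ₁θ = φ`, `Δ₁φ = g`,
  `g(τ) = [((τ.val ∕ L : ℕ) : ZMod M) = 0] − C` (block-constant), and `θ(τ₀ + 1) ≠ θ(τ₀)` for some `τ₀`.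
* §3 the `ℤ`-lift: `intCast_val_div` — `(((m : ZMod N).val ∕ L : ℕ) : ZMod M) = ((m ∕ L : ℤ) : ZMod M)` for `N = L·M`; ★ `third_difference_blockConstant` — for
  `ψ(m) := θ(m)`, the combination `(δ(m−1) − δ(m)) − (δ(m−2) − δ(m−1)) − ((δ(m) − δ(m+1)) − (δ(m−1) − δ(m)))`, `δ(j) = ψ(j) − ψ(j+1)`, equals `−g(m)`, a function of
  `m ∕ L` alone.

HONEST SCOPE.  Elementary linear algebra and integer arithmetic; no analysis; nothing of Bałaban.

References: T. Bałaban, CMP 99 (1985) 75–102 [Balaban1985RegularSpaces] ((1.38) p.82 — the clause this profile serves); CMP 99 (1985) 389–434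
[Balaban1985BackgroundPropagators] ((3.19), (3.24) pp.393–394 — the block transpose `Q′ᵀ`).
-/

set_option autoImplicit false
noncomputable section

open scoped BigOperators

namespace Summit.QuantumFields.YangMills.Theorems.Prop7VacuityBlockProfile

/-! ## §1 The second difference on the cycle `ZMod N`: summation by parts, kernel, range -/

section Cycle

variable {N : ℕ} [NeZero N]

/-- Re-indexing a sum over the cycle by `τ ↦ τ + 1`. [folklore] -/
theorem sum_shift_one (f : ZMod N → ℝ) : ∑ τ, f (τ + 1) = ∑ τ, f τ :=
  Fintype.sum_equiv (Equiv.addRight 1) _ _ (fun _ => rfl)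

/-- Re-indexing a sum over the cycle by `τ ↦ τ − 1`. [folklore] -/
theorem sum_shift_neg_one (f : ZMod N → ℝ) : ∑ τ, f (τ - 1) = ∑ τ, f τ :=
  Fintype.sum_equiv (Equiv.subRight 1) _ _ (fun _ => rfl)

/-- **THE SECOND DIFFERENCE HAS TOTAL ZERO** on the cycle. [folklore] -/
theorem sum_lap_eq_zero (ψ : ZMod N → ℝ) : ∑ τ, (ψ (τ + 1) - 2 * ψ τ + ψ (τ - 1)) = 0 := by
  simp only [Finset.sum_add_distrib, Finset.sum_sub_distrib, sum_shift_one, sum_shift_neg_one, ← Finset.mul_sum]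
  ring

/-- ★ **SUMMATION BY PARTS ON THE CYCLE**: `Σ_τ ψ(τ)·Δ₁ψ(τ) = −Σ_τ (ψ(τ+1) − ψ(τ))²`. [folklore] -/
theorem sum_mul_lap_eq_neg_sum_sq (ψ : ZMod N → ℝ) :
    ∑ τ, ψ τ * (ψ (τ + 1) - 2 * ψ τ + ψ (τ - 1)) = -∑ τ, (ψ (τ + 1) - ψ τ) ^ 2 := by
  have h1 : ∑ τ, ψ τ * ψ (τ - 1) = ∑ τ, ψ (τ + 1) * ψ τ := by
    rw [← sum_shift_one (fun τ => ψ τ * ψ (τ - 1))]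
    simp only [add_sub_cancel_right]
  have h2 : ∑ τ, ψ (τ + 1) ^ 2 = ∑ τ, ψ τ ^ 2 := sum_shift_one (fun τ => ψ τ ^ 2)
  have e1 : ∑ τ, ψ τ * (ψ (τ + 1) - 2 * ψ τ + ψ (τ - 1)) = ∑ τ, ψ (τ + 1) * ψ τ - 2 * ∑ τ, ψ τ ^ 2 + ∑ τ, ψ τ * ψ (τ - 1) := by
    rw [Finset.mul_sum, ← Finset.sum_sub_distrib, ← Finset.sum_add_distrib]
    exact Finset.sum_congr rfl fun τ _ => by ring
  have e2 : ∑ τ, (ψ (τ + 1) - ψ τ) ^ 2 = ∑ τ, ψ (τ + 1) ^ 2 - 2 * ∑ τ, ψ (τ + 1) * ψ τ + ∑ τ, ψ τ ^ 2 := by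
    rw [Finset.mul_sum, ← Finset.sum_sub_distrib, ← Finset.sum_add_distrib]
    exact Finset.sum_congr rfl fun τ _ => by ring
  rw [e1, e2, h1, h2]
  ring

/-- Every element of the cycle is reached from `0` by unit steps: induction along `τ.val`. [folklore] -/
theorem eq_apply_zero_of_succ_eq (ψ : ZMod N → ℝ) (h : ∀ τ, ψ (τ + 1) = ψ τ) (τ : ZMod N) : ψ τ = ψ 0 := by
  have key : ∀ n : ℕ, ψ (n : ZMod N) = ψ 0 := by
    intro n
    induction n with
    | zero => simp
    | succ n ih => rw [Nat.cast_succ, h, ih]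
  rw [← ZMod.natCast_zmod_val τ]
  exact key _

/-- **`Δ₁ψ = 0 ⇒ ψ` CONSTANT** on the cycle (the sum of squared increments vanishes). [folklore] -/
theorem eq_const_of_lap_eq_zero (ψ : ZMod N → ℝ) (h : ∀ τ, ψ (τ + 1) - 2 * ψ τ + ψ (τ - 1) = 0) (τ : ZMod N) : ψ τ = ψ 0 := by
  have hs : ∑ σ, (ψ (σ + 1) - ψ σ) ^ 2 = 0 := by
    have := sum_mul_lap_eq_neg_sum_sq ψ
    simp only [h, mul_zero, Finset.sum_const_zero] at this
    linarith
  have hall := (Finset.sum_eq_zero_iff_of_nonneg (fun σ _ => sq_nonneg (ψ (σ + 1) - ψ σ))).mp hs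
  refine eq_apply_zero_of_succ_eq ψ (fun σ => ?_) τ
  have := hall σ (Finset.mem_univ σ)
  exact sub_eq_zero.mp (pow_eq_zero_iff (n := 2) (by norm_num) |>.mp this)

/-- ★★ **THE SECOND DIFFERENCE MAPS ONTO THE MEAN-ZERO FUNCTIONS**: for every `h : ZMod N → ℝ` with `Σ h = 0` there is `φ` with `Δ₁φ = h` and `Σ φ = 0`.  The restriction of
`Δ₁` to the hyperplane `{Σ = 0}` is injective (`Δ₁φ = 0 ⇒ φ` constant `⇒ φ = 0`), hence — the hyperplane being finite-dimensional — surjective. [folklore] -/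
theorem exists_lap_eq_of_sum_eq_zero (h : ZMod N → ℝ) (hh : ∑ τ, h τ = 0) :
    ∃ φ : ZMod N → ℝ, (∀ τ, φ (τ + 1) - 2 * φ τ + φ (τ - 1) = h τ) ∧ ∑ τ, φ τ = 0 := by
  classical
  -- the mean functional and the hyperplane
  let σ : (ZMod N → ℝ) →ₗ[ℝ] ℝ :=
    { toFun := fun ψ => ∑ τ, ψ τ
      map_add' := fun ψ ψ' => by simp [Finset.sum_add_distrib]
      map_smul' := fun c ψ => by simp [Finset.mul_sum] }
  let V₀ : Submodule ℝ (ZMod N → ℝ) := LinearMap.ker σ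
  -- the second difference as a linear map into the hyperplane
  let Δ : (ZMod N → ℝ) →ₗ[ℝ] (ZMod N → ℝ) :=
    { toFun := fun ψ τ => ψ (τ + 1) - 2 * ψ τ + ψ (τ - 1)
      map_add' := fun ψ ψ' => by funext τ; simp only [Pi.add_apply]; ring
      map_smul' := fun c ψ => by funext τ; simp only [Pi.smul_apply, smul_eq_mul, RingHom.id_apply]; ring }
  have hΔmem : ∀ ψ : ZMod N → ℝ, Δ ψ ∈ V₀ := fun ψ => by
    show ∑ τ, (ψ (τ + 1) - 2 * ψ τ + ψ (τ - 1)) = 0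
    exact sum_lap_eq_zero ψ
  let Δ₀ : V₀ →ₗ[ℝ] V₀ := (Δ.domRestrict V₀).codRestrict V₀ (fun ψ => hΔmem ψ)
  -- injective on the hyperplane
  have hinj : Function.Injective Δ₀ := by
    rw [← LinearMap.ker_eq_bot, LinearMap.ker_eq_bot']
    intro ψ hψ
    have hψ0 : ∀ τ, (ψ : ZMod N → ℝ) (τ + 1) - 2 * (ψ : ZMod N → ℝ) τ + (ψ : ZMod N → ℝ) (τ - 1) = 0 := fun τ =>
      congrArg (fun f : V₀ => (f : ZMod N → ℝ) τ) hψ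
    have hc := eq_const_of_lap_eq_zero _ hψ0
    have hsum : ∑ τ, (ψ : ZMod N → ℝ) τ = 0 := ψ.2
    have hz : (ψ : ZMod N → ℝ) 0 = 0 := by
      have e : ∑ τ : ZMod N, (ψ : ZMod N → ℝ) τ = ∑ τ : ZMod N, (ψ : ZMod N → ℝ) 0 := Finset.sum_congr rfl fun τ _ => hc τ
      rw [e, Finset.sum_const, Finset.card_univ, ZMod.card, nsmul_eq_mul] at hsum
      have hN : (N : ℝ) ≠ 0 := by exact_mod_cast (NeZero.ne N)
      exact (mul_eq_zero.mp hsum).resolve_left hN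
    apply Subtype.ext
    funext τ
    rw [hc τ, hz]
    rfl
  -- hence surjective
  have hsurj : Function.Surjective Δ₀ := LinearMap.injective_iff_surjective.mp hinj
  obtain ⟨φ, hφ⟩ := hsurj ⟨h, LinearMap.mem_ker.mpr hh⟩
  exact ⟨(φ : ZMod N → ℝ), fun τ => congrArg (fun f : V₀ => (f : ZMod N → ℝ) τ) hφ, φ.2⟩

end Cycle

/-! ## §2 The block-constant pattern and the profile -/

section Profile

variable {N : ℕ} [NeZero N]

/-- ★★ **THE PROFILE.**  On the cycle `ZMod N`, `N = L·M` with `0 < L` and `1 < M` (at least two blocks of length `L`): there are `θ φ g` and a constant `C` with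
`Δ₁θ = φ`, `Δ₁φ = g`, `g = 𝟙{block index = 0} − C` (block index `τ ↦ ((τ.val ∕ L : ℕ) : ZMod M)`), and `θ` does NOT have constant increments. [folklore] -/
theorem exists_blockProfile {L M : ℕ} (hN : N = L * M) (hL : 0 < L) (hM : 1 < M) :
    ∃ (θ φ g : ZMod N → ℝ) (C : ℝ),
      (∀ τ, θ (τ + 1) - 2 * θ τ + θ (τ - 1) = φ τ) ∧
      (∀ τ, φ (τ + 1) - 2 * φ τ + φ (τ - 1) = g τ) ∧
      (∀ τ, g τ = (if (((τ.val / L : ℕ)) : ZMod M) = 0 then 1 else 0) - C) ∧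
      ∃ τ₀, θ (τ₀ + 1) ≠ θ τ₀ := by
  classical
  have hN0 : (N : ℝ) ≠ 0 := by exact_mod_cast (NeZero.ne N)
  let b : ZMod N → ℝ := fun τ => if (((τ.val / L : ℕ)) : ZMod M) = 0 then 1 else 0
  let C : ℝ := (∑ τ, b τ) / N
  let g : ZMod N → ℝ := fun τ => b τ - C
  have hg0 : ∑ τ, g τ = 0 := by
    show ∑ τ, (b τ - C) = 0
    rw [Finset.sum_sub_distrib, Finset.sum_const, Finset.card_univ, ZMod.card, nsmul_eq_mul]
    show ∑ τ, b τ - (N : ℝ) * ((∑ τ, b τ) / N) = 0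
    field_simp
    ring
  obtain ⟨φ, hφ, hφ0⟩ := exists_lap_eq_of_sum_eq_zero g hg0
  obtain ⟨θ, hθ, -⟩ := exists_lap_eq_of_sum_eq_zero φ hφ0
  refine ⟨θ, φ, g, C, hθ, hφ, fun τ => rfl, ?_⟩
  -- `θ` with constant increments would make `g ≡ 0`, but `g(0) ≠ g(L)`
  by_contra hcon
  have hcon' : ∀ τ, θ (τ + 1) = θ τ := fun τ => by
    by_contra h
    exact hcon ⟨τ, h⟩
  have hθc : ∀ τ, θ τ = θ 0 := eq_apply_zero_of_succ_eq θ hcon'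
  have hφz : ∀ τ, φ τ = 0 := fun τ => by rw [← hθ τ, hθc (τ + 1), hθc τ, hθc (τ - 1)]; ring
  have hgz : ∀ τ, g τ = 0 := fun τ => by rw [← hφ τ, hφz, hφz, hφz]; ring
  have hb0 : b 0 = 1 := by
    show (if (((((0 : ZMod N)).val / L : ℕ)) : ZMod M) = 0 then (1 : ℝ) else 0) = 1
    rw [ZMod.val_zero, Nat.zero_div, Nat.cast_zero, if_pos rfl]
  have hLN : L < N := by
    rw [hN]
    calc L = L * 1 := (mul_one L).symm
      _ < L * M := Nat.mul_lt_mul_of_pos_left hM hL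
  have hbL : b (L : ZMod N) = 0 := by
    show (if (((((L : ZMod N)).val / L : ℕ)) : ZMod M) = 0 then (1 : ℝ) else 0) = 0
    rw [ZMod.val_natCast, Nat.mod_eq_of_lt hLN, Nat.div_self hL, Nat.cast_one, if_neg]
    haveI : Fact (1 < M) := ⟨hM⟩
    exact one_ne_zero
  have h1 : g 0 = 1 - C := by show b 0 - C = 1 - C; rw [hb0]
  have h2 : g (L : ZMod N) = 0 - C := by show b (L : ZMod N) - C = 0 - C; rw [hbL]
  have := hgz 0
  have := hgz (L : ZMod N)
  linarith

end Profile

/-! ## §3 The `ℤ`-periodic lift: block indices and the third difference of the pure-gauge profile -/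

section Lift

/-- **BLOCK INDICES COMMUTE WITH THE LIFT**: for `N = L·M`, `0 < L`, the block index of the residue of `m : ℤ` is the residue mod `M` of `m ∕ L`.
[folklore] -/
theorem intCast_val_div {N L M : ℕ} [NeZero N] (hN : N = L * M) (hL : 0 < L) (m : ℤ) :
    ((((m : ZMod N).val / L : ℕ)) : ZMod M) = (((m / (L : ℤ)) : ℤ) : ZMod M) := by
  have hL0 : (L : ℤ) ≠ 0 := by exact_mod_cast hL.ne'
  have hval : (((m : ZMod N).val : ℕ) : ℤ) = m % (N : ℤ) := ZMod.val_intCast m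
  -- `m = N·q + r`, `r = m % N`
  set r : ℤ := m % (N : ℤ) with hr
  have hNc : (N : ℤ) = (L : ℤ) * (M : ℤ) := by exact_mod_cast hN
  have hdecomp : m = r + (L : ℤ) * ((M : ℤ) * (m / (N : ℤ))) := by
    have h0 := Int.emod_add_mul_ediv m (N : ℤ)
    rw [← hr] at h0
    rw [← mul_assoc, ← hNc]
    linarith
  have hdiv : m / (L : ℤ) = r / (L : ℤ) + (M : ℤ) * (m / (N : ℤ)) := by
    conv_lhs => rw [hdecomp]
    rw [Int.add_mul_ediv_left _ _ hL0]
  rw [← Int.cast_natCast, Int.natCast_div, hval, hdiv]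
  push_cast
  rw [ZMod.natCast_self, zero_mul, add_zero]

/-- ★ **THE THIRD DIFFERENCE OF THE PURE-GAUGE PROFILE IS BLOCK-CONSTANT**: for `a(m) = (t·(θ(m) − θ(m+1)))•s` lifted from the cycle (`θ` read at the residue of `m`), with
`Δ₁θ = φ`, `Δ₁φ = g` and `g` a function `b` of the block index minus a constant, the combination that FILE B-I's (1.38)-lemma reads,
`(a(m−1) − a(m)) − (a(m−2) − a(m−1)) − ((a(m) − a(m+1)) − (a(m−1) − a(m)))`, equals `(−t·(b(block of m) − C))•s`, a function of `m ∕ L` alone. [folklore] -/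
theorem third_difference_eq {E : Type*} [AddCommGroup E] [Module ℂ E] (s : E) (t : ℝ) {N L M : ℕ} [NeZero N] (hN : N = L * M) (hL : 0 < L)
    {θ φ g : ZMod N → ℝ} (hθ : ∀ τ, θ (τ + 1) - 2 * θ τ + θ (τ - 1) = φ τ) (hφ : ∀ τ, φ (τ + 1) - 2 * φ τ + φ (τ - 1) = g τ)
    (b : ZMod M → ℝ) (C : ℝ) (hg : ∀ τ, g τ = b ((((τ.val / L : ℕ)) : ZMod M)) - C)
    {a : ℤ → E} (ha : ∀ m : ℤ, a m = ((t * (θ (m : ZMod N) - θ ((m : ZMod N) + 1)) : ℝ) : ℂ) • s) (m : ℤ) :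
    (a (m - 1) - a m) - (a (m - 1 - 1) - a (m - 1)) - ((a m - a (m + 1)) - (a (m - 1) - a m))
      = ((-(t * (b ((((m / (L : ℤ)) : ℤ) : ZMod M)) - C)) : ℝ) : ℂ) • s := by
  set τ : ZMod N := (m : ZMod N) with hτ
  have c1 : ((m - 1 : ℤ) : ZMod N) = τ - 1 := by push_cast; rw [hτ]
  have c2 : ((m - 1 - 1 : ℤ) : ZMod N) = τ - 1 - 1 := by push_cast; rw [hτ]
  have c3 : ((m + 1 : ℤ) : ZMod N) = τ + 1 := by push_cast; rw [hτ]
  rw [ha, ha, ha, ha, c1, c2, c3]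
  simp only [sub_add_cancel, ← sub_smul, ← Complex.ofReal_sub]
  congr 2
  rw [← intCast_val_div hN hL m, ← hτ, ← hg τ]
  have e1 := hθ (τ + 1)
  have e2 := hθ τ
  have e3 := hθ (τ - 1)
  have e4 := hφ τ
  simp only [add_sub_cancel_right, sub_add_cancel] at e1 e3
  linear_combination (-t) * (e1 - 2 * e2 + e3 + e4)

end Lift

end Summit.QuantumFields.YangMills.Theorems.Prop7VacuityBlockProfile

end
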